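import Summits.ValiantsHypothesis.ValiantsHypothesis.Theorems.BinomialElusiveBinomialCandidateJetReductionEstimates

/-!
# Crux `BinomialElusive.BinomialCandidate` (stmt-ValiantsHypothesis-7392), line `registered` —
# stub `stub_jetReduction`, part 2/4: the Picard iteration and the polynomial `ψₙ`

Abstract setting (part 1): a commutative `R`-algebra `A` with a decreasing multiplicative
filtration `F : ℕ → A → Prop`.  Data: polynomials `B_j` (`j : σ`) and `B₀` in the variables `σ`
all of whose monomials have degree `≥ 2`, a linear form `ℓ : σ → R`, and `q, T : σ → A` of
level `1` solving the fixed-point system `q = T - B(q)`; put `T₀ := ℓ(q) + B₀(q)`.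

* The Picard iterates `Φ₀ = X`, `Φₙ₊₁ = X - B(Φₙ)` (vectors of polynomials in `X = (X_j)_j`)
  have no constant term, `Φₙ ≡ X (mod degree ≥ 2)`, `Φₙ₊₁ ≡ X - B (mod degree ≥ 3)`
  (`iter_degGE_one`, `iter_sub_X`, `iter_succ_jet`), and approximate the solution:
  `q ≡ Φₙ(T) (mod F (n + 2))` (`filt_sub_aeval_iter`, CLAIM A of the blueprint; induction on
  `n` with the key estimate of part 1).
* `ψ := ℓ(Φₙ) + B₀(Φₙ)` has no constant term, `ψ(T) ≡ T₀ (mod F (n + 2))` (`filt_sub_aeval_psi`),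
  its 2-jet is `ℓ(X - B) + B₀` (`psi_jet`), so if all coefficients of `ψ` of degree `≤ 2` vanish
  then `ℓ = 0` and `B₀ ≡ 0 (mod degree ≥ 3)` (`jet_vanishing`).
* `jetReduction_iterate` packages this as an existence statement (`∃ ψ, …`), and
  `jetReduction_iterateLaurent` is its instance `A = ℂ((t))` used by part 4.
-/

-- layout Summits/ValiantsHypothesis/ValiantsHypothesis forces the duplicated namespace component
set_option linter.dupNamespace false

namespace Summit.ValiantsHypothesis.ValiantsHypothesis.Theorems.BinomialCandidateStubs

open scoped BigOperators
open MvPolynomial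

namespace JetReduction

/-! ## Small facts on "all monomials of degree `≥ n`" -/

section DegGE

variable {σ R : Type*} [CommRing R]

/-- `X j` has no constant term. -/
theorem degGE_X (j : σ) : ∀ d : σ →₀ ℕ, d.degree < 1 → coeff d (X j : MvPolynomial σ R) = 0 := by
  classical
  intro d hd
  rw [coeff_X]
  split_ifs with h
  · subst h; simp at hd
  · rfl

/-- Closure under subtraction. -/
theorem degGE_sub {n : ℕ} {f g : MvPolynomial σ R} (hf : ∀ d : σ →₀ ℕ, d.degree < n → coeff d f = 0)
    (hg : ∀ d : σ →₀ ℕ, d.degree < n → coeff d g = 0) :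
    ∀ d : σ →₀ ℕ, d.degree < n → coeff d (f - g) = 0 :=
  fun d hd => by simp [hf d hd, hg d hd]

/-- Closure under multiplication by constants. -/
theorem degGE_C_mul {n : ℕ} (r : R) {f : MvPolynomial σ R}
    (hf : ∀ d : σ →₀ ℕ, d.degree < n → coeff d f = 0) :
    ∀ d : σ →₀ ℕ, d.degree < n → coeff d (C r * f) = 0 :=
  fun d hd => by simp [hf d hd]

/-- Closure under finite sums. -/
theorem degGE_sum {ι : Type*} {n : ℕ} (s : Finset ι) {f : ι → MvPolynomial σ R}
    (hf : ∀ i ∈ s, ∀ d : σ →₀ ℕ, d.degree < n → coeff d (f i) = 0) :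
    ∀ d : σ →₀ ℕ, d.degree < n → coeff d (∑ i ∈ s, f i) = 0 :=
  fun d hd => by rw [coeff_sum]; exact Finset.sum_eq_zero fun i hi => hf i hi d hd

/-- Weakening of the level. -/
theorem degGE_anti {n n' : ℕ} (h : n' ≤ n) {f : MvPolynomial σ R}
    (hf : ∀ d : σ →₀ ℕ, d.degree < n → coeff d f = 0) :
    ∀ d : σ →₀ ℕ, d.degree < n' → coeff d f = 0 :=
  fun d hd => hf d (lt_of_lt_of_le hd h)

/-- The coefficient of `X l` in `Σ_j C (ℓ j) * (X j - B j)` is `ℓ l` when the `B j` have no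
monomials of degree `< 2`. -/
theorem coeff_single_sum_C_mul_X_sub [Fintype σ] [DecidableEq σ] (ℓ : σ → R)
    (B : σ → MvPolynomial σ R) (hB : ∀ j, ∀ d : σ →₀ ℕ, d.degree < 2 → coeff d (B j) = 0) (l : σ) :
    coeff (Finsupp.single l 1) (∑ j, C (ℓ j) * (X j - B j)) = ℓ l := by
  rw [coeff_sum, Finset.sum_eq_single l]
  · rw [coeff_C_mul, coeff_sub, coeff_X_same, hB l _ (by simp), sub_zero, mul_one]
  · intro j _ hj
    rw [coeff_C_mul, coeff_sub, coeff_X, if_neg, hB j _ (by simp), sub_zero, mul_zero]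
    exact fun h => hj (Finsupp.single_left_injective one_ne_zero h)
  · simp

/-- Composition of substitutions. -/
theorem aeval_aeval {τ A : Type*} [CommRing A] [Algebra R A] (x : τ → A)
    (g : σ → MvPolynomial τ R) (f : MvPolynomial σ R) :
    aeval x (aeval g f) = aeval (fun i => aeval x (g i)) f := by
  rw [← AlgHom.comp_apply, comp_aeval]

end DegGE

/-! ## The Picard iteration -/

section Iteration

variable {R A : Type*} [CommRing R] [CommRing A] [Algebra R A] {F : ℕ → A → Prop}
  (hF : (∀ n, F n 0) ∧ (∀ n x y, F n x → F n y → F n (x + y)) ∧ (∀ n x, F n x → F n (-x)) ∧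
    (∀ a b x, a ≤ b → F b x → F a x) ∧ (∀ r, F 0 (algebraMap R A r)) ∧
    (∀ a b x y, F a x → F b y → F (a + b) (x * y)))
  {σ : Type*} {B : σ → MvPolynomial σ R} (hB : ∀ j, ∀ d : σ →₀ ℕ, d.degree < 2 → coeff d (B j) = 0)
  {Φ : ℕ → σ → MvPolynomial σ R} (hΦ0 : ∀ j, Φ 0 j = X j)
  (hΦ : ∀ n j, Φ (n + 1) j = X j - aeval (Φ n) (B j))

include hB hΦ0 hΦ in
/-- The iterates have no constant term. -/
theorem iter_degGE_one : ∀ (n : ℕ) (j : σ), ∀ d : σ →₀ ℕ, d.degree < 1 → coeff d (Φ n j) = 0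
  | 0, j => by rw [hΦ0]; exact degGE_X j
  | n + 1, j => by
    rw [hΦ]
    exact degGE_sub (degGE_X j) (degGE_anti one_le_two (aeval_degGE (hB j) (iter_degGE_one n)))

include hB hΦ0 hΦ in
/-- `Φₙ ≡ X (mod degree ≥ 2)`. -/
theorem iter_sub_X : ∀ (n : ℕ) (j : σ), ∀ d : σ →₀ ℕ, d.degree < 2 → coeff d (Φ n j - X j) = 0
  | 0, j => by simp [hΦ0]
  | n + 1, j => by
    rw [hΦ, sub_sub_cancel_left]
    exact (degGE_isFilt σ R).2.2.1 2 _ (aeval_degGE (hB j) (iter_degGE_one hB hΦ0 hΦ n))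

include hB hΦ0 hΦ in
/-- The 2-jet of the iterates: `Φₙ₊₁ ≡ X - B (mod degree ≥ 3)`. -/
theorem iter_succ_jet (n : ℕ) (j : σ) :
    ∀ d : σ →₀ ℕ, d.degree < 3 → coeff d (Φ (n + 1) j - (X j - B j)) = 0 := by
  rw [hΦ, sub_sub_sub_cancel_left]
  have h := aeval_sub_aeval_degGE (t := 1) (hB j) (fun i => degGE_X i)
    (iter_degGE_one hB hΦ0 hΦ n) (fun i => by
      simpa using (degGE_isFilt σ R).2.2.1 2 _ (iter_sub_X hB hΦ0 hΦ n i))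
  have hX : aeval X (B j) = B j := by simp
  rwa [hX] at h

variable {q T : σ → A} (hq : ∀ j, F 1 (q j)) (hT : ∀ j, F 1 (T j))
  (hfix : ∀ j, q j = T j - aeval q (B j))

include hF hB hΦ0 hΦ hT in
/-- The iterates evaluated at `T` are of level `1`. -/
theorem filt_aeval_iter (n : ℕ) (j : σ) : F 1 (aeval T (Φ n j)) :=
  filt_aeval hF (iter_degGE_one hB hΦ0 hΦ n j) hT

include hF hB hΦ0 hΦ hq hT hfix in
/-- **Approximation (CLAIM A).** A solution `q` of level `1` of `q = T - B(q)` (`T` of level `1`,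
`B` without monomials of degree `< 2`) agrees with the iterate `Φₙ(T)` to level `n + 2`. -/
theorem filt_sub_aeval_iter : ∀ (n : ℕ) (j : σ), F (n + 2) (q j - aeval T (Φ n j))
  | 0, j => by
    rw [hΦ0, aeval_X, hfix j, sub_sub_cancel_left]
    exact hF.2.2.1 2 _ (filt_aeval hF (hB j) hq)
  | n + 1, j => by
    rw [hΦ, map_sub, aeval_X, aeval_aeval, hfix j]
    have h := filt_aeval_sub_aeval hF (hB j) (fun i => filt_aeval_iter hF hB hΦ0 hΦ hT n i) hq
      (n + 1) (fun i => by simpa using hF.2.2.1 (n + 2) _ (filt_sub_aeval_iter n i))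
    have : T j - aeval q (B j) - (T j - aeval (fun i => aeval T (Φ n i)) (B j)) =
        aeval (fun i => aeval T (Φ n i)) (B j) - aeval q (B j) := by ring
    rw [this]
    exact h

/-! ## The polynomial `ψ = ℓ(Φₙ) + B₀(Φₙ)` -/

variable [Fintype σ] (ℓ : σ → R) {B₀ : MvPolynomial σ R}
  (hB₀ : ∀ d : σ →₀ ℕ, d.degree < 2 → coeff d B₀ = 0)
  {n : ℕ} {ψ : MvPolynomial σ R} (hψ : ψ = ∑ j, C (ℓ j) * Φ n j + aeval (Φ n) B₀)

include hB hΦ0 hΦ hB₀ hψ in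
/-- `ψ` has no constant term. -/
theorem psi_degGE_one : ∀ d : σ →₀ ℕ, d.degree < 1 → coeff d ψ = 0 := by
  rw [hψ]
  refine (degGE_isFilt σ R).2.1 1 _ _ (degGE_sum _ fun j _ => degGE_C_mul _ ?_) ?_
  · exact iter_degGE_one hB hΦ0 hΦ n j
  · exact degGE_anti one_le_two (aeval_degGE hB₀ (iter_degGE_one hB hΦ0 hΦ n))

include hB hΦ0 hΦ hB₀ hψ in
/-- The 2-jet of `ψ` (for `n ≥ 1`) is `ℓ(X - B) + B₀`. -/
theorem psi_jet (hn : 1 ≤ n) :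
    ∀ d : σ →₀ ℕ, d.degree < 3 → coeff d (ψ - (∑ j, C (ℓ j) * (X j - B j) + B₀)) = 0 := by
  obtain ⟨n, rfl⟩ : ∃ n', n = n' + 1 := ⟨n - 1, by omega⟩
  have h1 : ∀ d : σ →₀ ℕ, d.degree < 3 →
      coeff d (∑ j, C (ℓ j) * (Φ (n + 1) j - (X j - B j))) = 0 :=
    degGE_sum _ fun j _ => degGE_C_mul _ (iter_succ_jet hB hΦ0 hΦ n j)
  have h2 : ∀ d : σ →₀ ℕ, d.degree < 3 → coeff d (aeval (Φ (n + 1)) B₀ - aeval X B₀) = 0 :=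
    aeval_sub_aeval_degGE (t := 1) hB₀ (iter_degGE_one hB hΦ0 hΦ (n + 1))
      (fun i => degGE_X i) (fun i => iter_sub_X hB hΦ0 hΦ (n + 1) i)
  have hX : aeval X B₀ = B₀ := by simp
  rw [hX] at h2
  have key : ψ - (∑ j, C (ℓ j) * (X j - B j) + B₀) =
      ∑ j, C (ℓ j) * (Φ (n + 1) j - (X j - B j)) + (aeval (Φ (n + 1)) B₀ - B₀) := by
    rw [hψ]
    simp only [mul_sub, Finset.sum_sub_distrib]
    ring
  rw [key]
  exact (degGE_isFilt σ R).2.1 3 _ _ h1 h2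

include hB hΦ0 hΦ hB₀ hψ in
/-- If the 2-jet of `ψ` vanishes (`n ≥ 1`) then `ℓ = 0` and `B₀` has no monomials of degree
`≤ 2`. -/
theorem jet_vanishing [DecidableEq σ] (hn : 1 ≤ n)
    (h : ∀ d : σ →₀ ℕ, d.degree < 3 → coeff d ψ = 0) :
    (∀ j, ℓ j = 0) ∧ ∀ d : σ →₀ ℕ, d.degree < 3 → coeff d B₀ = 0 := by
  have hP : ∀ d : σ →₀ ℕ, d.degree < 3 → coeff d (∑ j, C (ℓ j) * (X j - B j) + B₀) = 0 := by
    simpa using degGE_sub h (psi_jet hB hΦ0 hΦ ℓ hB₀ hψ hn)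
  have hℓ : ∀ j, ℓ j = 0 := fun l => by
    have := hP (Finsupp.single l 1) (by simp)
    rwa [coeff_add, coeff_single_sum_C_mul_X_sub ℓ B hB, hB₀ _ (by simp), add_zero] at this
  refine ⟨hℓ, ?_⟩
  simpa [hℓ] using hP

include hF hB hΦ0 hΦ hq hT hfix hψ in
/-- **Congruence.** `T₀ = ℓ(q) + B₀(q)` agrees with `ψ(T)` to level `n + 2`. -/
theorem filt_sub_aeval_psi (hB₀ : ∀ d : σ →₀ ℕ, d.degree < 2 → coeff d B₀ = 0) {T₀ : A}
    (hT₀ : T₀ = ∑ j, algebraMap R A (ℓ j) * q j + aeval q B₀) : F (n + 2) (T₀ - aeval T ψ) := by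
  have h1 : F (n + 2) (∑ j, algebraMap R A (ℓ j) * (q j - aeval T (Φ n j))) :=
    filt_sum hF _ _ fun j _ => filt_algebraMap_mul hF _ (filt_sub_aeval_iter hF hB hΦ0 hΦ hq hT hfix n j)
  have h2 : F (n + 1 + 2) (aeval q B₀ - aeval (fun i => aeval T (Φ n i)) B₀) :=
    filt_aeval_sub_aeval hF hB₀ hq (fun i => filt_aeval_iter hF hB hΦ0 hΦ hT n i) (n + 1)
      (fun i => filt_sub_aeval_iter hF hB hΦ0 hΦ hq hT hfix n i)
  convert hF.2.1 _ _ _ h1 (hF.2.2.2.1 _ _ _ (by omega) h2) using 1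
  rw [hT₀, hψ, map_add, map_sum, aeval_aeval]
  simp only [map_mul, aeval_C, mul_sub, Finset.sum_sub_distrib]
  ring

end Iteration

/-- **Jet reduction — the abstract iteration theorem.**  In a commutative `R`-algebra `A` with a
decreasing multiplicative filtration `F`, let `q = T - B(q)` with `q, T` of level `1`
componentwise and `B` a family of polynomials without monomials of degree `< 2`, and let
`T₀ = ℓ(q) + B₀(q)` with `B₀` without monomials of degree `< 2`.  Then for every `n ≥ 1` there is
a polynomial `ψ` without constant term with `ψ(T) ≡ T₀ (mod F (n + 2))` such that the vanishing
of all its coefficients of degree `≤ 2` forces `ℓ = 0` and `B₀ ≡ 0 (mod degree ≥ 3)`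
(namely `ψ = ℓ(Φₙ) + B₀(Φₙ)` for the Picard iterates `Φ`). -/
theorem jetReduction_iterate {R A : Type*} [CommRing R] [CommRing A] [Algebra R A]
    {F : ℕ → A → Prop}
    (hF : (∀ n, F n 0) ∧ (∀ n x y, F n x → F n y → F n (x + y)) ∧ (∀ n x, F n x → F n (-x)) ∧
      (∀ a b x, a ≤ b → F b x → F a x) ∧ (∀ r, F 0 (algebraMap R A r)) ∧
      (∀ a b x y, F a x → F b y → F (a + b) (x * y)))
    {σ : Type*} [Fintype σ] [DecidableEq σ] (B : σ → MvPolynomial σ R) (ℓ : σ → R)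
    (B₀ : MvPolynomial σ R) (hB : ∀ j, ∀ d : σ →₀ ℕ, d.degree < 2 → coeff d (B j) = 0)
    (hB₀ : ∀ d : σ →₀ ℕ, d.degree < 2 → coeff d B₀ = 0) (q T : σ → A) (T₀ : A)
    (hq : ∀ j, F 1 (q j)) (hT : ∀ j, F 1 (T j)) (hfix : ∀ j, q j = T j - aeval q (B j))
    (hT₀ : T₀ = ∑ j, algebraMap R A (ℓ j) * q j + aeval q B₀) (n : ℕ) (hn : 1 ≤ n) :
    ∃ ψ : MvPolynomial σ R, (∀ d : σ →₀ ℕ, d.degree < 1 → coeff d ψ = 0) ∧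
      F (n + 2) (T₀ - aeval T ψ) ∧
      ((∀ d : σ →₀ ℕ, d.degree < 3 → coeff d ψ = 0) →
        (∀ j, ℓ j = 0) ∧ ∀ d : σ →₀ ℕ, d.degree < 3 → coeff d B₀ = 0) := by
  set Φ : ℕ → σ → MvPolynomial σ R :=
    fun m => (fun (Ψ : σ → MvPolynomial σ R) (j : σ) => X j - aeval Ψ (B j))^[m] X with hΦdef
  have hΦ0 : ∀ j, Φ 0 j = X j := fun j => rfl
  have hΦ : ∀ m j, Φ (m + 1) j = X j - aeval (Φ m) (B j) := fun m j => by
    simp only [hΦdef, Function.iterate_succ_apply']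
  refine ⟨∑ j, C (ℓ j) * Φ n j + aeval (Φ n) B₀, psi_degGE_one hB hΦ0 hΦ ℓ hB₀ rfl,
    filt_sub_aeval_psi hF hB hΦ0 hΦ hq hT hfix ℓ rfl hB₀ hT₀, jet_vanishing hB hΦ0 hΦ ℓ hB₀ rfl hn⟩

end JetReduction

/-- **Jet reduction, part 2 — the iteration in `ℂ((t))`** (helper of the stub
`stub_jetReduction`): `jetReduction_iterate` for `A = ℂ((t))` filtered `t`-adically. -/
theorem jetReduction_iterateLaurent :
    ∀ (k : ℕ) (B : Fin k → MvPolynomial (Fin k) ℂ) (ℓ : Fin k → ℂ) (B₀ : MvPolynomial (Fin k) ℂ)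
      (q T : Fin k → LaurentSeries ℂ) (T₀ : LaurentSeries ℂ) (n : ℕ),
      (∀ j, ∀ d : Fin k →₀ ℕ, d.degree < 2 → MvPolynomial.coeff d (B j) = 0) →
      (∀ d : Fin k →₀ ℕ, d.degree < 2 → MvPolynomial.coeff d B₀ = 0) →
      (∀ j, ∀ g : ℤ, g < (1 : ℕ) → (q j).coeff g = 0) →
      (∀ j, ∀ g : ℤ, g < (1 : ℕ) → (T j).coeff g = 0) →
      (∀ j, q j = T j - MvPolynomial.aeval q (B j)) →
      T₀ = ∑ j, algebraMap ℂ (LaurentSeries ℂ) (ℓ j) * q j + MvPolynomial.aeval q B₀ → 1 ≤ n →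
      ∃ ψ : MvPolynomial (Fin k) ℂ, (∀ d : Fin k →₀ ℕ, d.degree < 1 → MvPolynomial.coeff d ψ = 0) ∧
        (∀ g : ℤ, g < (n + 2 : ℕ) → (T₀ - MvPolynomial.aeval T ψ).coeff g = 0) ∧
        ((∀ d : Fin k →₀ ℕ, d.degree < 3 → MvPolynomial.coeff d ψ = 0) →
          (∀ j, ℓ j = 0) ∧ ∀ d : Fin k →₀ ℕ, d.degree < 3 → MvPolynomial.coeff d B₀ = 0) :=
  fun _ B ℓ B₀ q T T₀ n hB hB₀ hq hT hfix hT₀ hn =>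
    JetReduction.jetReduction_iterate
      (F := fun m (z : LaurentSeries ℂ) => ∀ g : ℤ, g < m → z.coeff g = 0)
      JetReduction.laurentGE_isFilt B ℓ B₀ hB hB₀ q T T₀ hq hT hfix hT₀ n hn

end Summit.ValiantsHypothesis.ValiantsHypothesis.Theorems.BinomialCandidateStubs
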